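import Literature.Probability.LatticeModels.IsoradialPercolation
import HarnessLib

/-!
# The dual isoradial graph `G*` and the dual rhombic embedding

Grimmett–Manolescu (*Bond percolation on isoradial graphs*, PTRF 159 (2014) = arXiv:1204.0505,
§2.2 and §4.1): "The graph `G` has a dual graph `G* = (V*, E*)`. Since `G` is isoradial, so is
`G*` [...] `G*` may be embedded in `ℝ²` with vertices at the centres of circumcircles, and edges
between circumcentres of abutting faces. Let `e* ∈ E*` be the dual edge crossing the primal
edge `e ∈ E`. Then `θ_{e*} = π - θ_e`, so that `p_e + p_{e*} = 1`"; §4.1: "From the diamond graph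
`G^◇` may be found both `G` and its planar dual `G*` [...] One of the graphs `G₁`, `G₂` is `G` and
the other is its dual `G*`. It follows in particular that `G*` is isoradial."

For a rhombic embedding `emb : RhombicEmbedding G F` (vertex positions `z`, face-centre
positions `c`, faces `leftFace d` / `rightFace d` of each dart) this file **defines**

* `RhombicEmbedding.dualGraph : SimpleGraph F` — two faces are adjacent iff they are the two
  faces of some dart of `G` (it is `emb.dualOpenGraph ∅`, the dual open graph of the empty
  configuration, `dualOpenGraph_empty`; every `dualOpenGraph ω` is a subgraph);
* `RhombicEmbedding.primalDart D` — a dart of `G` crossed by the dual dart `D = (f → g)` from its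
  left face `f` to its right face `g` (a choice; under isoradiality it has `leftFace = f`,
  `rightFace = g`, `leftFace_primalDart`/`rightFace_primalDart`, and under the tiling condition
  it is unique — see `Literature.Probability.Percolation.IsoradialDualProofs`);
* `RhombicEmbedding.dual : RhombicEmbedding emb.dualGraph V` — **the dual rhombic embedding**:
  the face `f` sits at `c f`, the "faces" of the dual graph are the primal vertices at `z`, and
  the faces left/right of the dual dart `f → g` crossing the primal dart `x → y` (with `f` on its
  left) are `y` and `x`. Its rhombi are the rhombi of `emb` with the roles of the two diagonals
  exchanged, so it is isoradial, a rhombic tiling, has BAP(ε) and the square-grid property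
  whenever `emb` does, and its canonical weights are `p_{e*} = 1 - p_e` (all proved in the
  `…DualProofs` companion);
* `RhombicEmbedding.dualDart d` — the dual dart `(leftFace d → rightFace d)` of a primal dart.

Orientation convention. No geometric orientation is imposed on `leftFace`/`rightFace` by
`IsIsoradial`, and none is needed: the convention "left of `f → g` is the head `y` of the primal
dart `x → y` having `f` on its left" is consistent under dart reversal
(`IsIsoradial.leftFace_symm` for the dual, proved in the companion file).

## References

* G. R. Grimmett, I. Manolescu, *Bond percolation on isoradial graphs: criticality and
  universality*, PTRF 159 (2014) 273–327, arXiv:1204.0505, §2.2 (the dual measure) and §4.1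
  (the diamond graph and the dual isoradial graph).
* G. Grimmett, *Percolation*, 2nd ed. (1999), §11.2 (planar duality).
-/

noncomputable section

namespace Literature.Probability.LatticeModels

namespace RhombicEmbedding

variable {V : Type*} {G : SimpleGraph V} {F : Type*} (emb : RhombicEmbedding G F)

/-! ### The dual graph -/

/-- **The dual graph `G*`** on the face type: `f` and `g` are adjacent iff they are the two faces
(`leftFace d`, `rightFace d`) of some dart `d` of `G`, i.e. iff the dual edge `e* = {f, g}`
crosses some primal edge `e`. (Grimmett–Manolescu 2014, §2.2 and §4.1: "edges between
circumcentres of abutting faces".) [cite: GrimmettManolescu2014Isoradial, §2.2 and §4.1 (the dual graph G*)] -/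
def dualGraph : SimpleGraph F :=
  SimpleGraph.fromRel fun f g => ∃ d : G.Dart, emb.leftFace d = f ∧ emb.rightFace d = g

/-- Adjacency in the dual graph, unfolded. [folklore] -/
theorem dualGraph_adj {f g : F} :
    emb.dualGraph.Adj f g ↔ f ≠ g ∧ ((∃ d : G.Dart, emb.leftFace d = f ∧ emb.rightFace d = g) ∨
      ∃ d : G.Dart, emb.leftFace d = g ∧ emb.rightFace d = f) := by
  simp only [dualGraph, SimpleGraph.fromRel_adj]

/-- The dual open graph of the empty configuration (every primal edge closed, so every dual
edge open) is the dual graph. [folklore] -/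
theorem dualOpenGraph_empty : emb.dualOpenGraph ∅ = emb.dualGraph := by
  ext f g
  simp only [dualOpenGraph, dualGraph, SimpleGraph.fromRel_adj, Set.mem_empty_iff_false,
    not_false_eq_true, and_true]

/-- Every dual open graph is a spanning subgraph of the dual graph. [folklore] -/
theorem dualOpenGraph_le_dualGraph (ω : Percolation.BondConfig V) :
    emb.dualOpenGraph ω ≤ emb.dualGraph := by
  rw [← dualOpenGraph_empty]
  exact emb.dualOpenGraph_antitone (Set.empty_subset ω)

/-- The two faces of a dart are adjacent in the dual graph as soon as they are distinct (always
the case under isoradiality, `IsIsoradial.c_leftFace_ne`). [folklore] -/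
theorem dualGraph_adj_leftFace_rightFace {d : G.Dart} (h : emb.leftFace d ≠ emb.rightFace d) :
    emb.dualGraph.Adj (emb.leftFace d) (emb.rightFace d) :=
  emb.dualGraph_adj.2 ⟨h, Or.inl ⟨d, rfl, rfl⟩⟩

/-! ### Primal darts crossed by dual darts -/

/-- From the adjacency of a dual dart: a primal dart having its two faces in one of the two
orders. [folklore] -/
theorem exists_dart_of_dualGraph_adj {f g : F} (h : emb.dualGraph.Adj f g)
    (h' : ¬ ∃ d : G.Dart, emb.leftFace d = f ∧ emb.rightFace d = g) :
    ∃ d : G.Dart, emb.leftFace d = g ∧ emb.rightFace d = f :=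
  ((emb.dualGraph_adj.1 h).2.resolve_left h')

/-- **A primal dart crossed by the dual dart `D = (f → g)` from left to right**: a dart `d` of
`G` with `leftFace d = f` and `rightFace d = g` if there is one, otherwise the reverse of a dart
with `leftFace = g`, `rightFace = f` (which exists by adjacency; under `IsIsoradial` the reverse
then has `leftFace = f`, `rightFace = g` as well, `leftFace_primalDart`). A choice
(`Classical.choose`); unique under the tiling condition. [folklore] -/
def primalDart (D : emb.dualGraph.Dart) : G.Dart :=
  open scoped Classical in
  if h : ∃ d : G.Dart, emb.leftFace d = D.fst ∧ emb.rightFace d = D.snd then h.choose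
  else (emb.exists_dart_of_dualGraph_adj D.adj h).choose.symm

/-- Under isoradiality the chosen primal dart has the source face of `D` on its left …
[folklore] -/
theorem leftFace_primalDart (hiso : emb.IsIsoradial) (D : emb.dualGraph.Dart) :
    emb.leftFace (emb.primalDart D) = D.fst := by
  unfold primalDart
  split_ifs with h
  · exact h.choose_spec.1
  · rw [hiso.leftFace_symm]
    exact (emb.exists_dart_of_dualGraph_adj D.adj h).choose_spec.2

/-- … and the target face of `D` on its right. [folklore] -/
theorem rightFace_primalDart (hiso : emb.IsIsoradial) (D : emb.dualGraph.Dart) :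
    emb.rightFace (emb.primalDart D) = D.snd := by
  unfold primalDart
  split_ifs with h
  · exact h.choose_spec.2
  · have hd := (emb.exists_dart_of_dualGraph_adj D.adj h).choose_spec.1
    rw [← hiso.leftFace_symm, SimpleGraph.Dart.symm_symm]
    exact hd

/-- **The dual dart of a primal dart** `d = (x → y)`: `leftFace d → rightFace d` (the faces are
distinct under isoradiality, which is therefore a hypothesis of this definition).
(Grimmett–Manolescu 2014, §2.2: `e*` is the dual edge crossing `e`.) [folklore] -/
def dualDart (hiso : emb.IsIsoradial) (d : G.Dart) : emb.dualGraph.Dart :=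
  ⟨(emb.leftFace d, emb.rightFace d), emb.dualGraph_adj_leftFace_rightFace fun h =>
    hiso.c_leftFace_ne d (congrArg emb.c h)⟩

/-- Components of the dual dart. [folklore] -/
@[simp] theorem dualDart_fst (hiso : emb.IsIsoradial) (d : G.Dart) :
    (emb.dualDart hiso d).fst = emb.leftFace d := rfl

/-- Components of the dual dart. [folklore] -/
@[simp] theorem dualDart_snd (hiso : emb.IsIsoradial) (d : G.Dart) :
    (emb.dualDart hiso d).snd = emb.rightFace d := rfl

/-- Reversing a primal dart reverses its dual dart. [folklore] -/
theorem dualDart_symm (hiso : emb.IsIsoradial) (d : G.Dart) :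
    emb.dualDart hiso d.symm = (emb.dualDart hiso d).symm := by
  ext
  · simp [dualDart, hiso.leftFace_symm]
  · have h := hiso.leftFace_symm d.symm
    rw [SimpleGraph.Dart.symm_symm] at h
    simp [dualDart, ← h]

/-! ### The dual rhombic embedding -/

/-- **The dual rhombic embedding.** The dual graph `G*` on the faces `F`, drawn with the face `f`
at its centre `c f`; its faces are the primal vertices, drawn at `z`; the faces to the left /
right of the dual dart `f → g` are the head `y` / tail `x` of the primal dart `x → y` crossed by
it from left to right (`primalDart`). The rhombus of the dual edge `e* = {f, g}` is the rhombus
of the primal edge `e = {x, y}` it crosses, with the roles of the diagonals exchanged.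
(Grimmett–Manolescu 2014, §4.1: `G` and `G*` are the two graphs read off the bipartite diamond
graph `G^◇`; §2.2: "`G*` may be embedded in `ℝ²` with vertices at the centres of circumcircles".)
[cite: GrimmettManolescu2014Isoradial, §4.1 (G and G* from the diamond graph); §2.2] -/
def dual : RhombicEmbedding emb.dualGraph V where
  z := emb.c
  c := emb.z
  leftFace D := (emb.primalDart D).snd
  rightFace D := (emb.primalDart D).fst

/-- The dual graph is drawn with the faces at their centres. [folklore] -/
@[simp] theorem dual_z : emb.dual.z = emb.c := rfl

/-- The faces of the dual embedding are the primal vertices, at their positions. [folklore] -/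
@[simp] theorem dual_c : emb.dual.c = emb.z := rfl

/-- The face to the left of a dual dart is the head of the primal dart it crosses. [folklore] -/
@[simp] theorem dual_leftFace (D : emb.dualGraph.Dart) :
    emb.dual.leftFace D = (emb.primalDart D).snd := rfl

/-- The face to the right of a dual dart is the tail of the primal dart it crosses. [folklore] -/
@[simp] theorem dual_rightFace (D : emb.dualGraph.Dart) :
    emb.dual.rightFace D = (emb.primalDart D).fst := rfl

end RhombicEmbedding

end Literature.Probability.LatticeModels
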